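import Mathlib
import Summits.ResolutionOfSingularities.ResolutionOfSingularities.Theorems.HomologicalConductorPersistenceStaircaseRecords
import Summits.ResolutionOfSingularities.ResolutionOfSingularities.Theorems.HomologicalConductorPersistenceCyclicQuotientOneModQ
import HarnessLib

/-!
# Rung S-2 `PersistenceSurface` (stmt-19970), stub C1 (`Sat₄`) — the family `1/n(1,q)`, `n = bq + 2` (`q` odd),
# PART A: the ring identities and the COVER PROPERTY of its parametric record staircase
# (chain W4.4b; T-V package, part 30a; seat leafhand-res-homologicalconduct-10 gen 2)

[OURS · L1 w44b · rung S-2] Nothing here is a statement of the manuscript under review (Hironaka 2017);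
AI-written, weaker than expert review.

The family `U = k[u,v]^{μ_n(1,q)}` with `n = bq + 2`, `b ≥ 1`, `q = 2h + 1 ≥ 3` (`ζ` a primitive `n`-th root of unity, `n ∈ kˣ`):
`n/q = [b + 1, 2, …, 2, 3]`, `e = h + 1`, `i`-series `(q, q − 2, q − 4, …, 3, 1)` — ALL odd numbers `≤ q`, so the cospecial family
is `{M_{−d} : d odd ≤ q}`, of size `(q+1)/2`, unbounded.  By the two-level recursion of the hand memo HAND10G2-TORIC-FAMILIES §1,
`drops_{(n,q)}(α) = q^{⌊α/q⌋} ++ drops_{(q, q−2)}(α mod q)` and the subsystem `(q, q−2)` is part 26's shape: for `α = qA + ρ`,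

* `ρ` odd:  generators `u^{α−qs} v^{s}` (`s ≤ A`), `v^{A + b(h − r) + 1}` (`ρ = 2r+1`): `Ω M_a ≅ M_{−q}^{A} ⊕ M_{−ρ}`;
* `ρ ≥ 2` even (`ρ = 2r`): …, `u v^{j₁}` with `j₁ = A + b(h − r + 1) + 1`, then `v^{j₁ + bh + 1}`: `Ω M_a ≅ M_{−q}^{A} ⊕ M_{−(ρ−1)} ⊕ M_{−1}`.

This file: the ring identities `odd_identity`, `even₁_identity`, `even₂_identity`, `climb_identity`, `climb_mul` and the cover
property `cover_plusTwo_mod_q` (the orbit CLIMBS by `2` between records; wrap certificates `v + q·i = α + W·n`).  Part B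
(`…CyclicQuotientPlusTwoModQ`) assembles `ca(U) = ca⁴(U) = ⋂_{d odd ≤ q} s̲ann(M_{−d})`.

References: folklore (Auslander 1986 / Herzog 1978 mechanism; Wunram 1988, Riemenschneider 1974); hand memo HAND10G2-TORIC-FAMILIES
(OURS, evidence on stmt-19970).
-/

-- single-problem summit: the doubled namespace component `ResolutionOfSingularities` is forced
set_option linter.dupNamespace false

noncomputable section

open Summit.ResolutionOfSingularities.ResolutionOfSingularities.Theorems.HomologicalConductor.PersistenceCyclicQuotientOneModQ
  (natCast_val_add_mul_self val_sub_natCast_eq val_neg_natCast)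

namespace Summit.ResolutionOfSingularities.ResolutionOfSingularities.Theorems.HomologicalConductor.PersistenceCyclicQuotientPlusTwoModQ

/-! ## Arithmetic: the ring identities -/

/-- Odd `ρ = 2r+1`: the closing generator, `q (A + b(h−r) + 1) = α + (h − r) n`. [folklore] -/
theorem odd_identity (q b A r h : ℕ) (hqh : q = 2 * h + 1) (hr : r ≤ h) :
    q * (A + b * (h - r) + 1) = (q * A + (2 * r + 1)) + (h - r) * (b * q + 2) := by
  zify [hr]
  subst hqh
  push_cast
  ring

/-- Even `ρ = 2r ≥ 2`: the middle generator `u v^{j₁}`, `1 + q j₁ = α + (h − r + 1) n`. [folklore] -/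
theorem even₁_identity (q b A r h : ℕ) (hqh : q = 2 * h + 1) (hr : r ≤ h) :
    1 + q * (A + b * (h - r + 1) + 1) = (q * A + 2 * r) + (h - r + 1) * (b * q + 2) := by
  zify [hr]
  subst hqh
  push_cast
  ring

/-- Even `ρ = 2r ≥ 2`: the closing generator, `q (A + b(2h−r+1) + 2) = α + (2h − r + 1) n`. [folklore] -/
theorem even₂_identity (q b A r h : ℕ) (hqh : q = 2 * h + 1) (hr : r ≤ h) :
    q * (A + b * (2 * h - r + 1) + 2) = (q * A + 2 * r) + (2 * h - r + 1) * (b * q + 2) := by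
  zify [hr, (by omega : r ≤ 2 * h)]
  subst hqh
  push_cast
  ring

/-- The climb certificate: `(ρ + 2m) + q (A + b m) = α + m n`. [folklore] -/
theorem climb_identity (q b A ρ m : ℕ) : ρ + 2 * m + q * (A + b * m) = (q * A + ρ) + m * (b * q + 2) := by
  ring

/-- `2m + q (b m) = m n`. [folklore] -/
theorem climb_mul (q b m : ℕ) : 2 * m + q * (b * m) = m * (b * q + 2) := by
  ring

/-! ## The cover property of the parametric staircase -/

/-- **Cover property** of the record staircase of a class `a` for `n = bq + 2` (`q = 2h+1 ≥ 3`, `b ≥ 1`), with the staircase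
functions written out exactly as consumed by `isotypic_le_span_of_cover` (`r = ρ/2`): every orbit position `i ≤ J` is dominated by a
generator.  Regime 1 (`i ≤ A`); the climb after `u^{ρ} v^{A}` (values `ρ + 2m`, big values in between); for even `ρ`, the second climb
after `u v^{j₁}`. [OURS · L1 w44b] -/
theorem cover_plusTwo_mod_q {n : ℕ} [NeZero n] {q b h : ℕ} (hqh : q = 2 * h + 1) (hb : 1 ≤ b) (hq : 3 ≤ q)
    (hnq : n = b * q + 2) (a : ZMod n) (i : ℕ)
    (hi : i ≤ (if a.val % q = 0 then a.val / q
      else if a.val % q % 2 = 1 then a.val / q + b * (h - a.val % q / 2) + 1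
      else a.val / q + b * (h - a.val % q / 2 + 1) + 1 + b * h + 1)) :
    ∃ s, s ≤ a.val / q + (if a.val % q = 0 then 0 else if a.val % q % 2 = 1 then 1 else 2) ∧
      (if s ≤ a.val / q then s else if a.val % q = 0 then a.val / q
        else if a.val % q % 2 = 1 then a.val / q + b * (h - a.val % q / 2) + 1
        else if s = a.val / q + 1 then a.val / q + b * (h - a.val % q / 2 + 1) + 1
        else a.val / q + b * (h - a.val % q / 2 + 1) + 1 + b * h + 1) ≤ i ∧
      (if s ≤ a.val / q then a.val - q * s else if a.val % q % 2 = 1 then 0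
        else if s = a.val / q + 1 then (if a.val % q = 0 then 0 else 1) else 0)
        ≤ ((a - ((q * i : ℕ) : ZMod n) : ZMod n)).val := by
  have hbq : q ≤ b * q := Nat.le_mul_of_pos_left q (by omega)
  have hA : q * (a.val / q) + a.val % q = a.val := Nat.div_add_mod _ _
  have hρq : a.val % q < q := Nat.mod_lt _ (by omega)
  have hlt : a.val < n := ZMod.val_lt a
  have hr2 : a.val % q / 2 * 2 ≤ a.val % q := Nat.div_mul_le_self _ _
  by_cases hiA : i ≤ a.val / q
  · have := Nat.mul_le_mul_left q hiA
    refine ⟨i, by omega, ?_, ?_⟩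
    · rw [if_pos hiA]
    · rw [if_pos hiA, val_sub_natCast_eq a (v := a.val - q * i) (w := 0) (by omega) (by omega)]
  · have h0 : ¬ a.val % q = 0 := by
      intro h0; rw [if_pos h0] at hi; exact hiA hi
    rw [if_neg h0] at hi
    simp only [if_neg h0]
    -- `i = A + m₀ + 1`
    obtain ⟨m₀, hm₀⟩ := Nat.exists_eq_add_of_lt (lt_of_not_ge hiA)
    by_cases hodd : a.val % q % 2 = 1
    · -- odd `ρ`: one climb, then the closing generator
      rw [if_pos hodd] at hi
      simp only [if_pos hodd]
      by_cases hiJ : i = a.val / q + b * (h - a.val % q / 2) + 1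
      · refine ⟨a.val / q + 1, by omega, ?_, ?_⟩
        · rw [if_neg (by omega)]; omega
        · rw [if_neg (by omega)]; exact Nat.zero_le _
      · -- inside the climb: `i − A = b m + δ`, value `ρ + 2m (+ n − qδ)`
        obtain ⟨m, δ, hmδ, hδb⟩ : ∃ m δ : ℕ, b * m + δ = m₀ + 1 ∧ δ < b :=
          ⟨(m₀ + 1) / b, (m₀ + 1) % b, Nat.div_add_mod _ _, Nat.mod_lt _ (by omega)⟩
        have hmh : m ≤ h - a.val % q / 2 := by
          by_contra hlt'
          have h' := Nat.mul_le_mul_left b (show h - a.val % q / 2 + 1 ≤ m by omega)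
          rw [Nat.mul_succ] at h'
          omega
        have hmtop : m = h - a.val % q / 2 → δ = 0 := by
          intro hm
          subst hm
          omega
        have hid := climb_identity q b (a.val / q) (a.val % q) m
        rw [hA, ← hnq] at hid
        refine ⟨a.val / q, by omega, ?_, ?_⟩
        · rw [if_pos le_rfl]; omega
        · rw [if_pos le_rfl, show a.val - q * (a.val / q) = a.val % q by omega]
          by_cases hδ0 : δ = 0
          · rw [val_sub_natCast_eq a (v := a.val % q + 2 * m) (w := m) (by omega)
              (by rw [hm₀, show a.val / q + m₀ + 1 = a.val / q + b * m by omega]; exact hid)]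
            omega
          · have hmlt : m < h - a.val % q / 2 := by
              rcases Nat.lt_or_ge m (h - a.val % q / 2) with h1 | h1
              · exact h1
              · exact absurd (hmtop (by omega)) hδ0
            have hqδ : q ≤ q * δ := Nat.le_mul_of_pos_right q (by omega)
            have hqδb : q * δ + q ≤ b * q := by
              have := Nat.mul_le_mul_left q (show δ + 1 ≤ b by omega)
              rw [Nat.mul_succ] at this; rw [Nat.mul_comm b]; exact this
            have hmn : (m + 1) * n = m * n + n := by ring
            rw [val_sub_natCast_eq a (v := a.val % q + 2 * m + n - q * δ) (w := m + 1) (by omega)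
              (by rw [hm₀, show a.val / q + m₀ + 1 = (a.val / q + b * m) + δ by omega, Nat.mul_add]; omega)]
            omega
    · -- even `ρ ≥ 2`: first climb to `j₁`, the generator `u v^{j₁}`, second climb, the closing generator
      rw [if_neg hodd] at hi
      simp only [if_neg hodd]
      have hev : a.val % q / 2 * 2 = a.val % q := by omega
      have hr1 : 1 ≤ a.val % q / 2 := by omega
      have hj₁ := even₁_identity q b (a.val / q) (a.val % q / 2) h hqh (by omega)
      rw [show q * (a.val / q) + 2 * (a.val % q / 2) = a.val by omega, ← hnq] at hj₁
      by_cases hi1 : i < a.val / q + b * (h - a.val % q / 2 + 1) + 1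
      · -- first climb: value `ρ + 2m (+ n − qδ)`, generator `u^{ρ} v^{A}`
        obtain ⟨m, δ, hmδ, hδb⟩ : ∃ m δ : ℕ, b * m + δ = m₀ + 1 ∧ δ < b :=
          ⟨(m₀ + 1) / b, (m₀ + 1) % b, Nat.div_add_mod _ _, Nat.mod_lt _ (by omega)⟩
        have hmh : m ≤ h - a.val % q / 2 + 1 := by
          by_contra hlt'
          have h' := Nat.mul_le_mul_left b (show h - a.val % q / 2 + 1 + 1 ≤ m by omega)
          rw [Nat.mul_succ] at h'
          omega
        have hmtop : m = h - a.val % q / 2 + 1 → δ = 0 := by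
          intro hm
          subst hm
          omega
        have hid := climb_identity q b (a.val / q) (a.val % q) m
        rw [hA, ← hnq] at hid
        refine ⟨a.val / q, by omega, ?_, ?_⟩
        · rw [if_pos le_rfl]; omega
        · rw [if_pos le_rfl, show a.val - q * (a.val / q) = a.val % q by omega]
          by_cases hδ0 : δ = 0
          · rw [val_sub_natCast_eq a (v := a.val % q + 2 * m) (w := m) (by omega)
              (by rw [hm₀, show a.val / q + m₀ + 1 = a.val / q + b * m by omega]; exact hid)]
            omega
          · have hmlt : m < h - a.val % q / 2 + 1 := by
              rcases Nat.lt_or_ge m (h - a.val % q / 2 + 1) with h1 | h1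
              · exact h1
              · exact absurd (hmtop (by omega)) hδ0
            have hqδ : q ≤ q * δ := Nat.le_mul_of_pos_right q (by omega)
            have hqδb : q * δ + q ≤ b * q := by
              have := Nat.mul_le_mul_left q (show δ + 1 ≤ b by omega)
              rw [Nat.mul_succ] at this; rw [Nat.mul_comm b]; exact this
            have hmn : (m + 1) * n = m * n + n := by ring
            rw [val_sub_natCast_eq a (v := a.val % q + 2 * m + n - q * δ) (w := m + 1) (by omega)
              (by rw [hm₀, show a.val / q + m₀ + 1 = (a.val / q + b * m) + δ by omega, Nat.mul_add]; omega)]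
            omega
      · by_cases hi1' : i = a.val / q + b * (h - a.val % q / 2 + 1) + 1
        · -- on the generator `u v^{j₁}`: value `1`
          refine ⟨a.val / q + 1, by omega, ?_, ?_⟩
          · rw [if_neg (by omega), if_pos rfl]; omega
          · rw [if_neg (by omega), if_pos rfl,
              val_sub_natCast_eq a (v := 1) (w := h - a.val % q / 2 + 1) (by omega) (by rw [hi1']; exact hj₁)]
        · by_cases hiJ : i = a.val / q + b * (h - a.val % q / 2 + 1) + 1 + b * h + 1
          · refine ⟨a.val / q + 2, by omega, ?_, ?_⟩
            · rw [if_neg (by omega), if_neg (by omega)]; omega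
            · rw [if_neg (by omega), if_neg (by omega)]; exact Nat.zero_le _
          · -- second climb from `j₁` (value `1`): `i − j₁ = b m + δ`, value `1 + 2m (+ n − qδ)`
            obtain ⟨m₁, hm₁⟩ := Nat.exists_eq_add_of_lt (show a.val / q + b * (h - a.val % q / 2 + 1) + 1 < i by omega)
            obtain ⟨m, δ, hmδ, hδb⟩ : ∃ m δ : ℕ, b * m + δ = m₁ + 1 ∧ δ < b :=
              ⟨(m₁ + 1) / b, (m₁ + 1) % b, Nat.div_add_mod _ _, Nat.mod_lt _ (by omega)⟩
            have hmh : m ≤ h := by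
              by_contra hlt'
              have h' := Nat.mul_le_mul_left b (show h + 1 ≤ m by omega)
              rw [Nat.mul_succ] at h'
              omega
            have hmtop : m = h → δ = 0 := by
              intro hm
              subst hm
              omega
            have hcm := climb_mul q b m
            rw [← hnq] at hcm
            refine ⟨a.val / q + 1, by omega, ?_, ?_⟩
            · rw [if_neg (by omega), if_pos rfl]; omega
            · rw [if_neg (by omega), if_pos rfl]
              by_cases hδ0 : δ = 0
              · rw [val_sub_natCast_eq a (v := 1 + 2 * m) (w := h - a.val % q / 2 + 1 + m) (by omega)
                  (by rw [hm₁, show a.val / q + b * (h - a.val % q / 2 + 1) + 1 + m₁ + 1 =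
                        (a.val / q + b * (h - a.val % q / 2 + 1) + 1) + b * m by omega, Nat.mul_add, Nat.add_mul];
                      omega)]
                omega
              · have hmlt : m < h := by
                  rcases Nat.lt_or_ge m h with h1 | h1
                  · exact h1
                  · exact absurd (hmtop (by omega)) hδ0
                have hqδ : q ≤ q * δ := Nat.le_mul_of_pos_right q (by omega)
                have hqδb : q * δ + q ≤ b * q := by
                  have := Nat.mul_le_mul_left q (show δ + 1 ≤ b by omega)
                  rw [Nat.mul_succ] at this; rw [Nat.mul_comm b]; exact this
                have hsplit : (h - a.val % q / 2 + 1 + (m + 1)) * n = (h - a.val % q / 2 + 1) * n + m * n + n := by ring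
                rw [val_sub_natCast_eq a (v := 1 + 2 * m + n - q * δ) (w := h - a.val % q / 2 + 1 + (m + 1)) (by omega)
                  (by rw [hm₁, show a.val / q + b * (h - a.val % q / 2 + 1) + 1 + m₁ + 1 =
                        ((a.val / q + b * (h - a.val % q / 2 + 1) + 1) + b * m) + δ by omega, Nat.mul_add, Nat.mul_add,
                        hsplit]; omega)]
                omega

end Summit.ResolutionOfSingularities.ResolutionOfSingularities.Theorems.HomologicalConductor.PersistenceCyclicQuotientPlusTwoModQ

end
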